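import Mathlib

/-!
# The Marzari–Vanderbilt spread functional on a `k`-mesh: the gauge-INVARIANT part `Ω_I`
# (spillage form), its invariance under band-mixing gauge transformations, `Ω ≥ Ω_I`, and the
# spillage as a projector mismatch (Souza–Marzari–Vanderbilt)

Every Wannier downfold in the cell's pipeline quotes a maximally-localised-Wannier-function (MLWF)
spread `Ω`; the disentanglement step of Wannier90 — and the first step of the (D) cRPA
construction — MINIMISES the gauge-invariant part `Ω_I` over trial subspaces
[SouzaMarzariVanderbilt2001, §III].  What is exact here, on a finite `k`-mesh with neighbour
shells `b` (weights `w_b`), `J` bands and overlap matrices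
`M^{(k,b)}_{mn} = ⟨u_{mk}|u_{n,k+b}⟩` [MarzariEtAl2012, §II.C.2; SouzaMarzariVanderbilt2001,
§II Eq. (5)]:

* the spread decomposes as `Ω = Ω_I + Ω̃`, `Ω̃ = Ω_OD + Ω_D`, with the discrete forms
  `Ω_I = (1/N) Σ_{k,b} w_b (J − Σ_{mn} |M^{(k,b)}_{mn}|²)`,
  `Ω_OD = (1/N) Σ_{k,b} w_b Σ_{m≠n} |M^{(k,b)}_{mn}|²`,
  `Ω_D = (1/N) Σ_{k,b} w_b Σ_n (−Im ln M^{(k,b)}_{nn} − b·r̄_n)²` [MarzariEtAl2012, §II.C.1–§II.C.2;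
  SouzaMarzariVanderbilt2001, §II Eqs. (6)–(7)];
* a gauge transformation `u_{nk} ↦ Σ_m U^{(k)}_{mn} u_{mk}` with `U^{(k)}` unitary
  [MarzariEtAl2012, §II.A.2; SouzaMarzariVanderbilt2001, §II Eq. (3)] acts on the overlaps by
  `M^{(k,b)} ↦ U^{(k)†} M^{(k,b)} U^{(k+b)}` [MarzariEtAl2012, §II.D];
* «`Ω_I` is gauge-invariant, since it is an intrinsic property of the manifold of states»
  [SouzaMarzariVanderbilt2001, §III.A]: here `OmegaI_gaugeAct`, from the unitary invariance of the
  Frobenius square-sum `Σ_{mn}|M_{mn}|² = tr(M Mᴴ)`;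
* both parts of `Ω̃` are sums of squares, so `Ω ≥ Ω_I` for non-negative shell weights
  (`OmegaI_le_Omega`): a printed MLWF `Ω` bounds the subspace quantity `Ω_I` from above, and two
  codes' `Ω` on the same window differ only through `Ω̃` once `Ω_I` agrees;
* the SPILLAGE `T_{k,b} = J − Σ_{mn}|M_{mn}|² = tr[P_k Q_{k+b}]`
  [SouzaMarzariVanderbilt2001, §III.B Eqs. (8)–(9)]: with the Bloch states as orthonormal columns
  `A` (at `k`) and `B` (at `k+b`) of matrices over a finite ambient index, `M = Aᴴ B` and
  `J − Σ|M|² = ‖(1 − B Bᴴ) A‖_F²` (`spillage_overlap_eq`) — hence `0 ≤ T ≤ J`, i.e. Bessel's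
  inequality `Σ_{mn} |⟨u_{mk}|u_{n,k+b}⟩|² ≤ J`, and `T = 0` for identical subspaces;
* one band (`J` a subsingleton): `Ω_OD = 0` — all gauge dependence of a single-band spread sits
  in `Ω_D` (`OmegaOD_eq_zero_of_subsingleton`).

Everything is PROVED (finite sums, matrices over `ℂ`); no named facts.  (`frobSq` here is the RECTANGULAR
complex square-sum `Σ_{ij}|M_{ij}|²` with its trace form; the tree's square-matrix
`Literature.Analysis.Matrix.frobSqNorm` (Hoffman–Wielandt file) is the `‖·‖²` variant on `n × n`
matrices and does not cover the rectangular isometry statements used in §3.)  NOT here: the continuum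
(`k`-integral) functional and the `O(b²)` finite-difference derivation of the discrete forms
(they are the cited DEFINITIONS), the minimisation algorithms, the reality of MLWFs, any
convergence statement, and the products `b·r̄_n` (taken as data `bdotr`).

References: N. Marzari, D. Vanderbilt, Phys. Rev. B 56 (1997) 12847 · I. Souza, N. Marzari,
D. Vanderbilt, Phys. Rev. B 65 (2001) 035109 (arXiv:cond-mat/0108084) · N. Marzari, A. A. Mostofi,
J. R. Yates, I. Souza, D. Vanderbilt, Rev. Mod. Phys. 84 (2012) 1419 (arXiv:1112.5411) §II.
AI-produced formalisation (H21, cell hubbard-downfold, seat lit-1, 2026-08-27).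
-/

noncomputable section

open scoped BigOperators ComplexConjugate

namespace Literature.MathematicalPhysics.QuantumLattice

namespace MLWF

open Matrix

/-! ## 1. The Frobenius square-sum `Σ_{ij} |M_{ij}|² = tr(M Mᴴ)` and its unitary invariance -/

section Frobenius

variable {m n p q : Type*} [Fintype m] [Fintype n] [Fintype p] [Fintype q]

/-- Frobenius square-sum of a complex matrix, `Σ_{ij} |M_{ij}|²` (the quantity `Σ_{mn}|M_{mn}|²`
of the discrete spread formulas). [cite: MarzariEtAl2012, §II.C.2] -/
def frobSq (M : Matrix m n ℂ) : ℝ := ∑ i, ∑ j, Complex.normSq (M i j)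

/-- [cite: MarzariEtAl2012, §II.C.2] Unfolding lemma. -/
theorem frobSq_def (M : Matrix m n ℂ) : frobSq M = ∑ i, ∑ j, Complex.normSq (M i j) := rfl

/-- [cite: MarzariEtAl2012, §II.C.2] `Σ|M_{ij}|² ≥ 0`. -/
theorem frobSq_nonneg (M : Matrix m n ℂ) : 0 ≤ frobSq M :=
  Finset.sum_nonneg fun _ _ => Finset.sum_nonneg fun _ _ => Complex.normSq_nonneg _

/-- [cite: MarzariEtAl2012, §II.C.2] In terms of norms: `frobSq M = Σ_{ij} ‖M_{ij}‖²`. -/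
theorem frobSq_eq_sum_norm_sq (M : Matrix m n ℂ) : frobSq M = ∑ i, ∑ j, ‖M i j‖ ^ 2 := by
  unfold frobSq
  simp [Complex.normSq_eq_norm_sq]

/-- [cite: MarzariEtAl2012, §II.C.1 (`Tr[(P r Q)(P r Q)†] = ‖P r Q‖²`)] The square-sum is a
trace: `tr(M Mᴴ) = Σ_{ij} |M_{ij}|²`. -/
theorem trace_mul_conjTranspose_self (M : Matrix m n ℂ) :
    Matrix.trace (M * Mᴴ) = (frobSq M : ℂ) := by
  unfold frobSq
  simp only [Matrix.trace, Matrix.diag, Matrix.mul_apply, Matrix.conjTranspose_apply,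
    Complex.ofReal_sum]
  refine Finset.sum_congr rfl fun i _ => Finset.sum_congr rfl fun j _ => ?_
  rw [Complex.star_def, Complex.mul_conj]

/-- [cite: MarzariEtAl2012, §II.C.1] `frobSq M = 0 ↔ M = 0`. -/
theorem frobSq_eq_zero_iff (M : Matrix m n ℂ) : frobSq M = 0 ↔ M = 0 := by
  constructor
  · intro h
    ext i j
    have hi : ∑ j, Complex.normSq (M i j) = 0 := by
      have := (Finset.sum_eq_zero_iff_of_nonneg (fun i _ =>
        Finset.sum_nonneg fun j _ => Complex.normSq_nonneg (M i j))).mp h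
      exact this i (Finset.mem_univ i)
    have hij : Complex.normSq (M i j) = 0 := by
      have := (Finset.sum_eq_zero_iff_of_nonneg (fun j _ => Complex.normSq_nonneg (M i j))).mp hi
      exact this j (Finset.mem_univ j)
    simpa using hij
  · intro h
    subst h
    simp [frobSq]

/-- [cite: MarzariEtAl2012, §II.C.1] Invariance under an ISOMETRY on the left (`Uᴴ U = 1`; in
particular a unitary): `Σ|(U M)_{ij}|² = Σ|M_{ij}|²`. -/
theorem frobSq_isometry_mul [DecidableEq m] (U : Matrix p m ℂ) (hU : Uᴴ * U = 1)
    (M : Matrix m n ℂ) :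
    frobSq (U * M) = frobSq M := by
  have h : (frobSq (U * M) : ℂ) = (frobSq M : ℂ) := by
    rw [← trace_mul_conjTranspose_self, ← trace_mul_conjTranspose_self,
      Matrix.conjTranspose_mul]
    calc Matrix.trace (U * M * (Mᴴ * Uᴴ))
        = Matrix.trace (U * (M * Mᴴ * Uᴴ)) := by simp only [Matrix.mul_assoc]
      _ = Matrix.trace (M * Mᴴ * Uᴴ * U) := by rw [Matrix.trace_mul_comm, Matrix.mul_assoc]
      _ = Matrix.trace (M * Mᴴ) := by rw [Matrix.mul_assoc, hU, Matrix.mul_one]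
  exact_mod_cast h

/-- [cite: MarzariEtAl2012, §II.C.1] Invariance under a CO-ISOMETRY on the right (`V Vᴴ = 1`; in
particular a unitary): `Σ|(M V)_{ij}|² = Σ|M_{ij}|²`. -/
theorem frobSq_mul_coisometry [DecidableEq n] (M : Matrix m n ℂ) (V : Matrix n q ℂ)
    (hV : V * Vᴴ = 1) :
    frobSq (M * V) = frobSq M := by
  have h : (frobSq (M * V) : ℂ) = (frobSq M : ℂ) := by
    rw [← trace_mul_conjTranspose_self, ← trace_mul_conjTranspose_self,
      Matrix.conjTranspose_mul]
    calc Matrix.trace (M * V * (Vᴴ * Mᴴ))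
        = Matrix.trace (M * (V * Vᴴ) * Mᴴ) := by simp only [Matrix.mul_assoc]
      _ = Matrix.trace (M * Mᴴ) := by rw [hV, Matrix.mul_one]
  exact_mod_cast h

/-- [cite: MarzariEtAl2012, §II.D (`M^{(k,b)} = U^{(k)†} M^{(0)(k,b)} U^{(k+b)}`)] The two-sided
gauge action of unitaries leaves the square-sum unchanged. -/
theorem frobSq_conj_unitary [DecidableEq m] [DecidableEq n] (U : Matrix m m ℂ) (V : Matrix n n ℂ)
    (hU : U * Uᴴ = 1) (hV : V * Vᴴ = 1) (M : Matrix m n ℂ) :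
    frobSq (Uᴴ * M * V) = frobSq M := by
  rw [frobSq_mul_coisometry _ V hV, frobSq_isometry_mul]
  simpa using hU

/-- [cite: MarzariEtAl2012, §II.C.2] The identity matrix on `J` states: `Σ|1_{ij}|² = |J|`. -/
theorem frobSq_one [DecidableEq m] : frobSq (1 : Matrix m m ℂ) = Fintype.card m := by
  unfold frobSq
  simp [Matrix.one_apply, Finset.sum_ite_eq, apply_ite Complex.normSq]

end Frobenius

/-! ## 2. `Ω_I`, `Ω_OD`, `Ω_D` on a finite mesh; gauge invariance of `Ω_I`; `Ω ≥ Ω_I` -/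

section Mesh

variable {K B J : Type*} [Fintype K] [Fintype B] [Fintype J]

/-- The SPILLAGE of one `(k, b)` pair, `T_{k,b} = J − Σ_{mn} |M^{(k,b)}_{mn}|²`.
[cite: SouzaMarzariVanderbilt2001, §III.B Eq. (9)] -/
def spillage (M : Matrix J J ℂ) : ℝ := Fintype.card J - frobSq M

/-- The gauge-invariant part of the spread on a mesh of `N = |K|` points with shell weights
`w_b`: `Ω_I = (1/N) Σ_{k,b} w_b (J − Σ_{mn}|M^{(k,b)}_{mn}|²)`.
[cite: MarzariEtAl2012, §II.C.2; SouzaMarzariVanderbilt2001, §II Eq. (7)] -/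
def OmegaI (w : B → ℝ) (M : K → B → Matrix J J ℂ) : ℝ :=
  (1 / Fintype.card K) * ∑ k, ∑ b, w b * spillage (M k b)

/-- The band-off-diagonal part `Ω_OD = (1/N) Σ_{k,b} w_b Σ_{m≠n} |M^{(k,b)}_{mn}|²`.
[cite: MarzariEtAl2012, §II.C.2] -/
def OmegaOD [DecidableEq J] (w : B → ℝ) (M : K → B → Matrix J J ℂ) : ℝ :=
  (1 / Fintype.card K) * ∑ k, ∑ b, w b * ∑ i, ∑ j, if i = j then 0 else Complex.normSq (M k b i j)

/-- The band-diagonal part `Ω_D = (1/N) Σ_{k,b} w_b Σ_n (−Im ln M^{(k,b)}_{nn} − b·r̄_n)²`, with the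
products `b·r̄_n` supplied as data `bdotr b n`. [cite: MarzariEtAl2012, §II.C.2] -/
def OmegaD (w : B → ℝ) (bdotr : B → J → ℝ) (M : K → B → Matrix J J ℂ) : ℝ :=
  (1 / Fintype.card K) * ∑ k, ∑ b, w b * ∑ n, (-(Complex.log (M k b n n)).im - bdotr b n) ^ 2

/-- The total discrete spread `Ω = Ω_I + Ω̃`, `Ω̃ = Ω_OD + Ω_D`.
[cite: MarzariEtAl2012, §II.C.1–§II.C.2; SouzaMarzariVanderbilt2001, §II Eq. (6)] -/
def Omega [DecidableEq J] (w : B → ℝ) (bdotr : B → J → ℝ) (M : K → B → Matrix J J ℂ) : ℝ :=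
  OmegaI w M + OmegaOD w M + OmegaD w bdotr M

/-- The gauge action on the overlaps, `M^{(k,b)} ↦ U^{(k)†} M^{(k,b)} U^{(k+b)}`, with the mesh
neighbour map `nb k b = k + b` supplied as data. [cite: MarzariEtAl2012, §II.D] -/
def gaugeAct (nb : K → B → K) (U : K → Matrix J J ℂ) (M : K → B → Matrix J J ℂ) :
    K → B → Matrix J J ℂ :=
  fun k b => (U k)ᴴ * M k b * U (nb k b)

/-- [cite: SouzaMarzariVanderbilt2001, §III.B Eq. (9)] Unfolding lemma. -/
theorem spillage_def (M : Matrix J J ℂ) : spillage M = Fintype.card J - frobSq M := rfl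

/-- [cite: MarzariEtAl2012, §II.C.2] Unfolding lemma. -/
theorem OmegaI_def (w : B → ℝ) (M : K → B → Matrix J J ℂ) :
    OmegaI w M = (1 / Fintype.card K) * ∑ k, ∑ b, w b * spillage (M k b) := rfl

omit [Fintype K] [Fintype B] in
/-- [cite: MarzariEtAl2012, §II.D] Unfolding lemma. -/
theorem gaugeAct_apply (nb : K → B → K) (U : K → Matrix J J ℂ) (M : K → B → Matrix J J ℂ)
    (k : K) (b : B) : gaugeAct nb U M k b = (U k)ᴴ * M k b * U (nb k b) := rfl

omit [Fintype K] [Fintype B] in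
/-- [cite: SouzaMarzariVanderbilt2001, §III.A] The spillage of each `(k,b)` pair is unchanged by a
unitary gauge transformation. -/
theorem spillage_gaugeAct [DecidableEq J] (nb : K → B → K) {U : K → Matrix J J ℂ}
    (hU : ∀ k, U k * (U k)ᴴ = 1) (M : K → B → Matrix J J ℂ) (k : K) (b : B) :
    spillage (gaugeAct nb U M k b) = spillage (M k b) := by
  unfold spillage gaugeAct
  rw [frobSq_conj_unitary (U k) (U (nb k b)) (hU k) (hU (nb k b))]

/-- **Gauge invariance of `Ω_I`** [cite: SouzaMarzariVanderbilt2001, §III.A («for an isolated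
group of bands Ω_I is gauge-invariant, since it is an intrinsic property of the manifold of
states»); MarzariEtAl2012 §II.C.1]: for unitary `U^{(k)}` at every mesh point,
`Ω_I(U† M U) = Ω_I(M)`. -/
theorem OmegaI_gaugeAct [DecidableEq J] (w : B → ℝ) (nb : K → B → K) {U : K → Matrix J J ℂ}
    (hU : ∀ k, U k * (U k)ᴴ = 1) (M : K → B → Matrix J J ℂ) :
    OmegaI w (gaugeAct nb U M) = OmegaI w M := by
  unfold OmegaI
  congr 1
  refine Finset.sum_congr rfl fun k _ => Finset.sum_congr rfl fun b _ => ?_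
  rw [spillage_gaugeAct nb hU M k b]

/-- [cite: MarzariEtAl2012, §II.C.2] `Ω_OD ≥ 0` for non-negative shell weights. -/
theorem OmegaOD_nonneg [DecidableEq J] {w : B → ℝ} (hw : ∀ b, 0 ≤ w b)
    (M : K → B → Matrix J J ℂ) : 0 ≤ OmegaOD w M := by
  unfold OmegaOD
  apply mul_nonneg (by positivity)
  refine Finset.sum_nonneg fun k _ => Finset.sum_nonneg fun b _ => mul_nonneg (hw b) ?_
  refine Finset.sum_nonneg fun i _ => Finset.sum_nonneg fun j _ => ?_
  split_ifs
  · exact le_rfl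
  · exact Complex.normSq_nonneg _

/-- [cite: MarzariEtAl2012, §II.C.2] `Ω_D ≥ 0` for non-negative shell weights. -/
theorem OmegaD_nonneg {w : B → ℝ} (hw : ∀ b, 0 ≤ w b) (bdotr : B → J → ℝ)
    (M : K → B → Matrix J J ℂ) : 0 ≤ OmegaD w bdotr M := by
  unfold OmegaD
  apply mul_nonneg (by positivity)
  exact Finset.sum_nonneg fun k _ => Finset.sum_nonneg fun b _ =>
    mul_nonneg (hw b) (Finset.sum_nonneg fun n _ => sq_nonneg _)

/-- **`Ω ≥ Ω_I`** [cite: MarzariEtAl2012, §II.C.1 («not only Ω̃ but also Ω_I is positive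
definite»); SouzaMarzariVanderbilt2001 §II («both of them non-negative»)]: for non-negative shell
weights the total discrete spread bounds its gauge-invariant part from above, in ANY gauge. -/
theorem OmegaI_le_Omega [DecidableEq J] {w : B → ℝ} (hw : ∀ b, 0 ≤ w b) (bdotr : B → J → ℝ)
    (M : K → B → Matrix J J ℂ) : OmegaI w M ≤ Omega w bdotr M := by
  unfold Omega
  have h1 := OmegaOD_nonneg hw M
  have h2 := OmegaD_nonneg hw bdotr M
  linarith

/-- [cite: MarzariEtAl2012, §II.C.2] Consequently `Ω_I(M) ≤ Ω(U† M U)` for EVERY unitary gauge: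
no gauge choice brings the spread below the subspace quantity `Ω_I`. -/
theorem OmegaI_le_Omega_gaugeAct [DecidableEq J] {w : B → ℝ} (hw : ∀ b, 0 ≤ w b)
    (bdotr : B → J → ℝ) (nb : K → B → K) {U : K → Matrix J J ℂ} (hU : ∀ k, U k * (U k)ᴴ = 1)
    (M : K → B → Matrix J J ℂ) : OmegaI w M ≤ Omega w bdotr (gaugeAct nb U M) := by
  rw [← OmegaI_gaugeAct w nb hU M]
  exact OmegaI_le_Omega hw bdotr _

/-- [cite: MarzariEtAl2012, §II.C.2] ONE band: `Ω_OD = 0` — for a single band all gauge dependence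
of the spread is in `Ω_D`. -/
theorem OmegaOD_eq_zero_of_subsingleton [DecidableEq J] [Subsingleton J] (w : B → ℝ)
    (M : K → B → Matrix J J ℂ) : OmegaOD w M = 0 := by
  unfold OmegaOD
  have : ∀ k b, (∑ i : J, ∑ j : J, if i = j then (0 : ℝ) else Complex.normSq (M k b i j)) = 0 := by
    intro k b
    refine Finset.sum_eq_zero fun i _ => Finset.sum_eq_zero fun j _ => ?_
    simp [Subsingleton.elim i j]
  simp [this]

/-- [cite: MarzariEtAl2012, §II.C.2] ONE band: the spread is `Ω_I + Ω_D`. -/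
theorem Omega_of_subsingleton [DecidableEq J] [Subsingleton J] (w : B → ℝ) (bdotr : B → J → ℝ)
    (M : K → B → Matrix J J ℂ) : Omega w bdotr M = OmegaI w M + OmegaD w bdotr M := by
  unfold Omega
  rw [OmegaOD_eq_zero_of_subsingleton, add_zero]

end Mesh

/-! ## 3. The spillage as a projector mismatch: `J − Σ|M|² = ‖(1 − B Bᴴ) A‖²` for `M = Aᴴ B` -/

section Spillage

variable {X J : Type*} [Fintype X] [Fintype J] [DecidableEq X] [DecidableEq J]

/-- [cite: SouzaMarzariVanderbilt2001, §III.B Eq. (9) (`T_{k,b} = N − Σ|M|² = tr[P_k Q_{k+b}]`)]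
With the `J` Bloch states at `k` and at `k+b` given as ORTHONORMAL columns `A`, `B` over a finite
ambient index `X` (`Aᴴ A = 1`, `Bᴴ B = 1`), the overlap matrix is `M = Aᴴ B` and the spillage is
the Frobenius norm of the part of `A` outside the span of `B`:
`J − Σ_{mn}|M_{mn}|² = ‖(1 − B Bᴴ) A‖_F²`. -/
theorem spillage_overlap_eq (A B : Matrix X J ℂ) (hA : Aᴴ * A = 1) (hB : Bᴴ * B = 1) :
    spillage (Aᴴ * B) = frobSq ((1 - B * Bᴴ) * A) := by
  -- idempotent Hermitian complement `Q = 1 − B Bᴴ`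
  set Q : Matrix X X ℂ := 1 - B * Bᴴ with hQ
  have hQh : Qᴴ = Q := by
    simp [hQ, Matrix.conjTranspose_sub, Matrix.conjTranspose_mul]
  have hQ2 : Q * Q = Q := by
    have hP : B * Bᴴ * (B * Bᴴ) = B * Bᴴ := by
      calc B * Bᴴ * (B * Bᴴ) = B * (Bᴴ * B) * Bᴴ := by simp only [Matrix.mul_assoc]
        _ = B * Bᴴ := by rw [hB, Matrix.mul_one]
    simp only [hQ, Matrix.sub_mul, Matrix.mul_sub, Matrix.one_mul, Matrix.mul_one, hP]
    abel
  -- both sides as complex traces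
  have hL : ((spillage (Aᴴ * B) : ℝ) : ℂ) = Matrix.trace (A * Aᴴ) - Matrix.trace (A * Aᴴ * (B * Bᴴ)) := by
    unfold spillage
    push_cast
    rw [← trace_mul_conjTranspose_self, Matrix.conjTranspose_mul, Matrix.conjTranspose_conjTranspose]
    have h1 : Matrix.trace (A * Aᴴ) = (Fintype.card J : ℂ) := by
      rw [Matrix.trace_mul_comm, hA, Matrix.trace_one]
    have h2 : Matrix.trace (Aᴴ * B * (Bᴴ * A)) = Matrix.trace (A * Aᴴ * (B * Bᴴ)) := by
      calc Matrix.trace (Aᴴ * B * (Bᴴ * A)) = Matrix.trace (Aᴴ * (B * Bᴴ) * A) := by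
            simp only [Matrix.mul_assoc]
        _ = Matrix.trace (A * (Aᴴ * (B * Bᴴ))) := by rw [Matrix.trace_mul_comm]
        _ = Matrix.trace (A * Aᴴ * (B * Bᴴ)) := by simp only [Matrix.mul_assoc]
    rw [h1, h2]
  have hR : ((frobSq (Q * A) : ℝ) : ℂ) = Matrix.trace (A * Aᴴ) - Matrix.trace (A * Aᴴ * (B * Bᴴ)) := by
    rw [← trace_mul_conjTranspose_self, Matrix.conjTranspose_mul, hQh]
    calc Matrix.trace (Q * A * (Aᴴ * Q)) = Matrix.trace (Q * (A * Aᴴ) * Q) := by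
          simp only [Matrix.mul_assoc]
      _ = Matrix.trace (Q * (Q * (A * Aᴴ))) := by rw [Matrix.trace_mul_comm]
      _ = Matrix.trace (Q * Q * (A * Aᴴ)) := by simp only [Matrix.mul_assoc]
      _ = Matrix.trace (Q * (A * Aᴴ)) := by rw [hQ2]
      _ = Matrix.trace (A * Aᴴ * Q) := by rw [Matrix.trace_mul_comm]
      _ = Matrix.trace (A * Aᴴ) - Matrix.trace (A * Aᴴ * (B * Bᴴ)) := by
          simp only [hQ, Matrix.mul_sub, Matrix.mul_one, Matrix.trace_sub]
  exact_mod_cast hL.trans hR.symm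

/-- [cite: SouzaMarzariVanderbilt2001, §III.B Eq. (9)] Hence the spillage of an overlap matrix of
orthonormal sets is NON-NEGATIVE — Bessel's inequality `Σ_{mn} |⟨u_{mk}|u_{n,k+b}⟩|² ≤ J`. -/
theorem spillage_overlap_nonneg (A B : Matrix X J ℂ) (hA : Aᴴ * A = 1) (hB : Bᴴ * B = 1) :
    0 ≤ spillage (Aᴴ * B) := by
  rw [spillage_overlap_eq A B hA hB]
  exact frobSq_nonneg _

/-- [cite: SouzaMarzariVanderbilt2001, §III.B Eq. (9)] Bessel form: `Σ_{mn} |(Aᴴ B)_{mn}|² ≤ J`. -/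
theorem frobSq_overlap_le_card (A B : Matrix X J ℂ) (hA : Aᴴ * A = 1) (hB : Bᴴ * B = 1) :
    frobSq (Aᴴ * B) ≤ Fintype.card J := by
  have := spillage_overlap_nonneg A B hA hB
  unfold spillage at this
  linarith

omit [Fintype X] [DecidableEq X] [DecidableEq J] in
/-- [cite: SouzaMarzariVanderbilt2001, §III.B Eq. (9)] … and `T ≤ J` always. -/
theorem spillage_le_card (M : Matrix J J ℂ) : spillage M ≤ Fintype.card J := by
  unfold spillage
  have := frobSq_nonneg M
  linarith

omit [DecidableEq X] in
/-- [cite: SouzaMarzariVanderbilt2001, §III.B («vanishing when they are identical»)] Identical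
subspaces have zero spillage: `T(Aᴴ A) = T(1) = 0`. -/
theorem spillage_self (A : Matrix X J ℂ) (hA : Aᴴ * A = 1) : spillage (Aᴴ * A) = 0 := by
  rw [hA]
  unfold spillage
  rw [frobSq_one]
  ring

/-- [cite: SouzaMarzariVanderbilt2001, §III.B Eq. (9)] Zero spillage characterised: for
orthonormal `A`, `B`, `T(Aᴴ B) = 0` iff `A` lies in the span of `B` (`(1 − B Bᴴ) A = 0`). -/
theorem spillage_overlap_eq_zero_iff (A B : Matrix X J ℂ) (hA : Aᴴ * A = 1) (hB : Bᴴ * B = 1) :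
    spillage (Aᴴ * B) = 0 ↔ (1 - B * Bᴴ) * A = 0 := by
  rw [spillage_overlap_eq A B hA hB, frobSq_eq_zero_iff]

/-- [cite: SouzaMarzariVanderbilt2001, §II Eq. (7)] `Ω_I ≥ 0` when every overlap matrix of the
mesh is an overlap of orthonormal sets (`M^{(k,b)} = A_kᴴ A_{k+b}`) and the weights are
non-negative. -/
theorem OmegaI_nonneg_of_overlaps {K B : Type*} [Fintype K] [Fintype B] {w : B → ℝ}
    (hw : ∀ b, 0 ≤ w b) (nb : K → B → K) (A : K → Matrix X J ℂ) (hA : ∀ k, (A k)ᴴ * A k = 1) :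
    0 ≤ OmegaI w (fun k b => (A k)ᴴ * A (nb k b)) := by
  unfold OmegaI
  apply mul_nonneg (by positivity)
  exact Finset.sum_nonneg fun k _ => Finset.sum_nonneg fun b _ =>
    mul_nonneg (hw b) (spillage_overlap_nonneg _ _ (hA k) (hA (nb k b)))

end Spillage

end MLWF

end Literature.MathematicalPhysics.QuantumLattice
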